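import Summits.ResolutionOfSingularities.ResolutionOfSingularities.Theorems.FrobeniusLadderFInjectiveMacaulayficationFedderAtMaximalIdeal
import Mathlib.Algebra.MvPolynomial.PDeriv
import HarnessLib

/-!
# The DERIVATIVE CERTIFICATE for Fedder's clause: partial derivatives preserve Frobenius powers, so an iterated partial outside `P` forbids `g ∈ P^{[p]}`
# (crux `FInjectiveMacaulayfication` stmt-ResolutionOfSingularities-15315, chain w45a; res-L1-w45a-plan-1 RULING R21.17 (3)(a) «stub-1: the generic DERIVATIVE-CERTIFICATE LEMMA
# (derivations preserve Q^{[p]}: D(aᵖb) = aᵖD(b)) as `…DerivativeCertificate.lean`; res-L1-w45a-idea-1 g26's O4/O5 (memo Q13-r1.md 3ef182927dd3abe4, TCa's five derivative certificates)»;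
# seat res-L1-w45a-stub-1 g12)

[OURS · L1 W4.5a] Support file (`--supports stmt-ResolutionOfSingularities-15315 --as helper`); def-free; UNCONDITIONAL; no named fact; NOT a statement of any manuscript.
AI-written (AI review is weaker than expert review).

For a polynomial ring `k[X]` over a field of characteristic `p`:
* §1 `pderiv_mem_span_pow_image` — `∂_j` maps the ideal `(sᵖ : s ∈ S)` into itself (`∂(r·sᵖ) = ∂r·sᵖ + r·p·sᵖ⁻¹∂s = ∂r·sᵖ`); in particular ★ `pderiv_mem_frobeniusPower`
  (`∂_j (Q^{[p]}) ⊆ Q^{[p]}` for `frobeniusPower p Q`) and `iterPderiv_mem_span_pow_image` / `iterPderiv_mem_frobeniusPower` for any word of partials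
  (`iterPderiv l g = ∂_{l₀} ∂_{l₁} ⋯ g`, a `List.foldr`, no new definition: stated with the `foldr` term).
* §2 ★★ `not_mem_span_pow_of_iterPderiv_not_mem` — THE CERTIFICATE: if some iterated partial of `g` lies outside an ideal `Q ⊇ (sᵖ : s ∈ S)` (e.g. is a non-zero constant and
  `Q ≠ ⊤`), then `g ∉ (sᵖ : s ∈ S)`; `not_mem_frobeniusPower_of_iterPderiv_not_mem` (the `Q^{[p]}` form, `Q^{[p]} ⊆ Q`); `not_mem_span_pow_of_iterPderiv_eq_C` (unit-constant form).
* §3 ★★ `fedder_clause_of_iterPderiv_not_mem` — FEDDER'S CLAUSE BY A DERIVATIVE CERTIFICATE: at a maximal `P = (a₁,…,a_m)` of `k[X]` with `g ∈ P`, `g ≠ 0`, if some iterated partial of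
  `g^{p−1}` lies outside `P`, then `(k[X]/(g))_P` satisfies the crux's per-stalk clause (CM + Frobenius-closed parameter ideals) — `FedderAtMaximalIdeal.fedder_criterion_maximalIdeal`
  + §2. For `p = 2` the certificate is about `g` itself (res-L1-w45a-idea-1's TCa certificates: a chain of partials ending in `1`).
[cite: Fedder1983, Prop. 1.7 and Thm. 1.12] [folklore: derivations vanish on p-th powers in characteristic p]
-/

-- single-problem summit: the doubled namespace component is forced
set_option linter.dupNamespace false

noncomputable section

open MvPolynomial Literature.RingTheory.TightClosure

namespace Summit.ResolutionOfSingularities.ResolutionOfSingularities.Theorems.FInjectiveMacaulayfication.DerivativeCertificate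

open Summit.ResolutionOfSingularities.ResolutionOfSingularities.Theorems.FInjectiveMacaulayfication

variable {k : Type} [Field k] {σ : Type} (p : ℕ) [CharP k p]

/-! ## §1 Partial derivatives preserve ideals generated by `p`-th powers -/

/-- In characteristic `p`, `∂_j (sᵖ) = 0`. [folklore] -/
theorem pderiv_pow_p_eq_zero (j : σ) (s : MvPolynomial σ k) : pderiv j (s ^ p) = 0 := by
  rw [Derivation.leibniz_pow, smul_eq_mul, nsmul_eq_mul]
  have hp : ((p : ℕ) : MvPolynomial σ k) = 0 := by
    rw [← map_natCast (C : k →+* MvPolynomial σ k) p, CharP.cast_eq_zero k p, map_zero]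
  rw [hp, zero_mul]

/-- `∂_j` maps the ideal `(sᵖ : s ∈ S)` into itself: `∂(r·sᵖ) = (∂r)·sᵖ`. [folklore] -/
theorem pderiv_mem_span_pow_image (j : σ) (S : Set (MvPolynomial σ k)) (h : MvPolynomial σ k)
    (hh : h ∈ Ideal.span ((fun s : MvPolynomial σ k => s ^ p) '' S)) :
    pderiv j h ∈ Ideal.span ((fun s : MvPolynomial σ k => s ^ p) '' S) := by
  induction hh using Submodule.span_induction with
  | mem x hx =>
    obtain ⟨s, -, rfl⟩ := hx
    rw [pderiv_pow_p_eq_zero p j s]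
    exact zero_mem _
  | zero => rw [map_zero]; exact zero_mem _
  | add x y _ _ hx hy => rw [map_add]; exact add_mem hx hy
  | smul r x hx hx' =>
    rw [smul_eq_mul, Derivation.leibniz, smul_eq_mul, smul_eq_mul]
    exact add_mem (Ideal.mul_mem_left _ _ hx') (Ideal.mul_mem_right _ _ hx)

/-- ★ `∂_j (Q^{[p]}) ⊆ Q^{[p]}` for the Frobenius power `frobeniusPower p Q = (qᵖ : q ∈ Q)`. [folklore] -/
theorem pderiv_mem_frobeniusPower (j : σ) (Q : Ideal (MvPolynomial σ k)) (h : MvPolynomial σ k) (hh : h ∈ frobeniusPower p Q) :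
    pderiv j h ∈ frobeniusPower p Q :=
  pderiv_mem_span_pow_image p j (Q : Set (MvPolynomial σ k)) h hh

/-- Every word of partials `∂_{l₀} ∂_{l₁} ⋯` maps `(sᵖ : s ∈ S)` into itself. [folklore] -/
theorem iterPderiv_mem_span_pow_image (S : Set (MvPolynomial σ k)) :
    ∀ (l : List σ) (h : MvPolynomial σ k), h ∈ Ideal.span ((fun s : MvPolynomial σ k => s ^ p) '' S) →
      l.foldr (fun i g => pderiv i g) h ∈ Ideal.span ((fun s : MvPolynomial σ k => s ^ p) '' S)
  | [], h, hh => by simpa using hh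
  | j :: l, h, hh => by
    rw [List.foldr_cons]
    exact pderiv_mem_span_pow_image p j S _ (iterPderiv_mem_span_pow_image S l h hh)

/-- Every word of partials maps `Q^{[p]}` into itself. [folklore] -/
theorem iterPderiv_mem_frobeniusPower (Q : Ideal (MvPolynomial σ k)) (l : List σ) (h : MvPolynomial σ k) (hh : h ∈ frobeniusPower p Q) :
    l.foldr (fun i g => pderiv i g) h ∈ frobeniusPower p Q :=
  iterPderiv_mem_span_pow_image p (Q : Set (MvPolynomial σ k)) l h hh

/-! ## §2 The certificate -/

/-- ★★ **THE DERIVATIVE CERTIFICATE.** If some iterated partial of `g` lies outside an ideal `Q ⊇ (sᵖ : s ∈ S)`, then `g ∉ (sᵖ : s ∈ S)`. [folklore] -/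
theorem not_mem_span_pow_of_iterPderiv_not_mem (S : Set (MvPolynomial σ k)) (Q : Ideal (MvPolynomial σ k))
    (hSQ : Ideal.span ((fun s : MvPolynomial σ k => s ^ p) '' S) ≤ Q) (g : MvPolynomial σ k) (l : List σ)
    (hl : l.foldr (fun i g => pderiv i g) g ∉ Q) :
    g ∉ Ideal.span ((fun s : MvPolynomial σ k => s ^ p) '' S) :=
  fun hg => hl (hSQ (iterPderiv_mem_span_pow_image p S l g hg))

omit [CharP k p] in
/-- `Q^{[p]} ⊆ Q`. [folklore] -/
theorem frobeniusPower_le [Fact p.Prime] (Q : Ideal (MvPolynomial σ k)) : frobeniusPower p Q ≤ Q := by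
  unfold frobeniusPower
  rw [Ideal.span_le]
  rintro _ ⟨q, hq, rfl⟩
  exact Q.pow_mem_of_mem hq p (Fact.out : p.Prime).pos

/-- ★★ The `Q^{[p]}` form: an iterated partial of `g` outside `Q` forbids `g ∈ Q^{[p]}`. [folklore] -/
theorem not_mem_frobeniusPower_of_iterPderiv_not_mem [Fact p.Prime] (Q : Ideal (MvPolynomial σ k)) (g : MvPolynomial σ k) (l : List σ)
    (hl : l.foldr (fun i g => pderiv i g) g ∉ Q) : g ∉ frobeniusPower p Q :=
  not_mem_span_pow_of_iterPderiv_not_mem p (Q : Set (MvPolynomial σ k)) Q (frobeniusPower_le p Q) g l hl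

/-- Unit-constant form: an iterated partial equal to a NON-ZERO CONSTANT forbids `g ∈ (sᵖ : s ∈ S)` for every proper `Q ⊇ (sᵖ)`. [folklore] -/
theorem not_mem_span_pow_of_iterPderiv_eq_C (S : Set (MvPolynomial σ k)) (Q : Ideal (MvPolynomial σ k)) (hQ : Q ≠ ⊤)
    (hSQ : Ideal.span ((fun s : MvPolynomial σ k => s ^ p) '' S) ≤ Q) (g : MvPolynomial σ k) (l : List σ) (c : k) (hc : c ≠ 0)
    (hl : l.foldr (fun i g => pderiv i g) g = C c) :
    g ∉ Ideal.span ((fun s : MvPolynomial σ k => s ^ p) '' S) := by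
  refine not_mem_span_pow_of_iterPderiv_not_mem p S Q hSQ g l ?_
  rw [hl]
  intro hmem
  apply hQ
  rw [Ideal.eq_top_iff_one]
  have := Q.mul_mem_left (C c⁻¹) hmem
  rwa [← map_mul, inv_mul_cancel₀ hc, C_1] at this

/-! ## §3 Fedder's clause by a derivative certificate -/

omit [CharP k p] in
/-- `(aᵢᵖ : i) = (sᵖ : s ∈ range a)`. [plumbing] -/
theorem span_range_pow_eq {m : ℕ} (a : Fin m → MvPolynomial σ k) :
    Ideal.span (Set.range fun i : Fin m => a i ^ p) = Ideal.span ((fun s : MvPolynomial σ k => s ^ p) '' Set.range a) := by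
  rw [← Set.range_comp]
  rfl

/-- ★★ **FEDDER'S CLAUSE BY A DERIVATIVE CERTIFICATE.** `P = (a₁, …, a_m)` a maximal ideal of `k[X_0..X_{n-1}]` (`char k = p`), `g ∈ P`, `g ≠ 0`; if some iterated partial
`∂_{l₀}∂_{l₁}⋯ (g^{p−1})` lies OUTSIDE `P`, then the hypersurface local ring `k[X]_P/(g)` satisfies the crux's per-stalk clause: every system of parameters is weakly regular
and every parameter ideal is Frobenius closed (Fedder: `g^{p−1} ∉ P^{[p]}`, and `P^{[p]} = (aᵢᵖ)` is stable under partials). For `p = 2` the certificate concerns `g` itself.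
[cite: Fedder1983, Prop. 1.7 and Thm. 1.12] -/
theorem fedder_clause_of_iterPderiv_not_mem [Fact p.Prime] {n m : ℕ} (P : Ideal (MvPolynomial (Fin n) k)) [P.IsMaximal]
    (a : Fin m → MvPolynomial (Fin n) k) (hP : P = Ideal.span (Set.range a))
    (g : MvPolynomial (Fin n) k) (hgP : g ∈ P) (hg0 : g ≠ 0) (l : List (Fin n))
    (hl : l.foldr (fun i h => pderiv i h) (g ^ (p - 1)) ∉ P) :
    ∀ d : ℕ, ringKrullDim (Localization.AtPrime P ⧸ Ideal.span
        {algebraMap (MvPolynomial (Fin n) k) (Localization.AtPrime P) g}) = d →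
      ∀ s : Fin d → Localization.AtPrime P ⧸ Ideal.span
          {algebraMap (MvPolynomial (Fin n) k) (Localization.AtPrime P) g},
        Ideal.IsMaximal (Ideal.radical (Ideal.span (Set.range s))) →
          RingTheory.Sequence.IsWeaklyRegular (Localization.AtPrime P ⧸ Ideal.span
              {algebraMap (MvPolynomial (Fin n) k) (Localization.AtPrime P) g}) (List.ofFn s) ∧
          ∀ y : Localization.AtPrime P ⧸ Ideal.span
              {algebraMap (MvPolynomial (Fin n) k) (Localization.AtPrime P) g},
            (∃ e : ℕ, y ^ p ^ e ∈ Ideal.span ((fun z : Localization.AtPrime P ⧸ Ideal.span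
                {algebraMap (MvPolynomial (Fin n) k) (Localization.AtPrime P) g} => z ^ p ^ e) ''
                  (Ideal.span (Set.range s) : Set (Localization.AtPrime P ⧸ Ideal.span
                    {algebraMap (MvPolynomial (Fin n) k) (Localization.AtPrime P) g})))) →
              y ∈ Ideal.span (Set.range s) := by
  refine (FedderAtMaximalIdeal.fedder_criterion_maximalIdeal k n m p P a hP g hgP hg0).mpr ?_
  rw [span_range_pow_eq p a]
  refine not_mem_span_pow_of_iterPderiv_not_mem p (Set.range a) P ?_ (g ^ (p - 1)) l hl
  rw [Ideal.span_le]
  rintro _ ⟨_, ⟨i, rfl⟩, rfl⟩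
  have hai : a i ∈ P := by rw [hP]; exact Ideal.subset_span ⟨i, rfl⟩
  exact P.pow_mem_of_mem hai p (Fact.out : p.Prime).pos

end Summit.ResolutionOfSingularities.ResolutionOfSingularities.Theorems.FInjectiveMacaulayfication.DerivativeCertificate

end
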